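import Summits.QuantumFields.YangMills.Theses.HyperbolicRegulator
import Summits.QuantumFields.YangMills.Theorems.CurvatureAnchorR.Negative.FalseWithoutFloor
import Summits.QuantumFields.YangMills.Theorems.CurvatureAnchorR.Negative.EulerCharacteristic

/-!
# Disproof of `CurvatureAnchorR` (stmt-QuantumFields-18155) — findings

Standing disprover's work file (seat `refuter-cdisprove-stmt-QuantumFields-18155-0`, cycle 1, 2026-08-17) for the crux
`Summit.QuantumFields.YangMills.Theses.HyperbolicRegulator.CurvatureAnchorR` (route `HyperbolicRegulator`, file rev 5;
the R-a repair of `CurvatureAnchor`, whose kill `Cruxes/CurvatureAnchor/Disproof.lean` / `…CurvatureAnchorRefutation`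
does NOT recur: `AdmR.chart_avoids_cones`, and every `AdmR` clause is certified on the Bring `{4,5}_k` models,
`k = 8..24`, by the vetting refuter).  Prose lives in docstrings; everything below elaborates, no `sorry`.

**VERDICT (cycle 1): NO KILL.**  The statement is `∀ G (compact simple Lie) ∀ r, ∃ family, ADM ∧ ANCHOR` with
`ADM := ∀ k j, 8 ≤ k → AdmR k j (family k j)` (G-free, satisfiable) and
`ANCHOR := ∃ c > 0, ∀ k ≥ 8, ∃ β₀, ∀ β ≥ β₀, ∀ A B (supp ≤ ⌊k/8⌋), ∃ C j₀, ∀ j ≥ j₀, clustering at rate c/k over C′-flat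
quadruples`.  A refutation needs, for ONE certified `G` (we have `SU(2)`), a rigorous LOWER bound on truncated correlations
of 4-d lattice Yang–Mills on `S_kj × S_kj` at giant `β`, beating `C e^{-(c/k)·dist}` for EVERY `c > 0` along `j → ∞`, for
EVERY admissible family — nothing of the kind is in print or in reach (§4).  What IS landed: the load-bearing analysis of
the one droppable hypothesis (§1) and the Euler/toron identity every admissible complex obeys (§2).

## Findings index
* §0 `reading`            — quantifier audit of the typed statement (docstring only).
* §1 `floor_load_bearing` — `8 ≤ k` is LOAD-BEARING: the crux with the floor deleted is false
  (`Negative.curvatureAnchorR_false_without_floor`, landed p172332).  `hG` / faithfulness of `r`: NOT load-bearing for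
  truth (docstring `hG_not_load_bearing_note`) — no `_false_without_` lemma can exist for them.
* §2 `euler`              — clauses 1, 2, 4 force `2|E| = 4|V| + |K|`, `|E| = 2|Q|`; with 5, 8: `4 ≤ |K|`, `|V| + 1 ≤ |Q|`,
  i.e. `χ = −|K|/4 ≤ −1` for EVERY admissible complex (`Negative.admR_euler`, `Negative.curvatureAnchorR_euler`, landed
  p172390): no admissible complex is simply connected; `b₁(S; 𝔽₂) = 2 − χ ≥ 3`; the flat-connection (toron) sector of
  `S × S` is non-trivial at every `(k, j)` and cannot be typed away by the choice of family.
* §3 `junk_audit`         — why the cheap kills fail (docstring): no junk group / representation / observable, no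
  `Γ.dist = 0` exploit, no zero denominator, clustering quadruples non-vacuous (clause 8 ⇒ deep pairs at distance ≥ j).
* §4 `toron_floor_note`   — the toron / zero-mode covariance floor at fixed `(k, β)`, `j → ∞`, and why it does not refute
  the ∃-crux (docstring, with the estimate).
* §5 Line `witten_hessian` (PICKED 2026-08-17T18:19Z; skeleton sha `c8040c64…`): stub audit — NO stub false, NO typing
  slip found; per-stub notes + three kernel-checked micro-lemmas the stubs silently rely on:
  `square_boundary_telescopes` (`d₁ ∘ d₀ = 0` for the `KunnethGap`/`SqCx` sign conventions — `stub_kunneth`),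
  `instantiate_arith` (`stub_instantiate` obligation (1)), `mix_threshold` (the `2k <` vertex-disjointness of `Mix`).
* `-- Targets`: none served (payload `targets = []`); nothing sorried.

## §0 reading (symbol by symbol)
`G : Type` with `[Group] [TopologicalSpace] [IsTopologicalGroup] [CompactSpace]`, `IsCompactSimpleLieGroup G`
(`= IsSimpleCompactGroup G ∧ Nonempty (LatticeRep G)`; excludes finite, abelian and trivial `G`; `SU(n)`, `n ≥ 2`,
certified), Borel σ-algebra by `letI`; `r : LatticeRep G` (faithful continuous unitary, enters only through the action
`S`).  `Fam k j V E Q σ τ bd cV cE : Prop × (ℝ → ℝ → ℝ → YMSpecies G → YMSpecies G → Prop)`; `.1` = admissibility (nine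
clauses, ℕ-division throughout: flat `k/2 < dist`, deep `3*(k/4) < dist`, chart box `(k:ℤ)/4`, Poincaré `10^6 k²`);
`.2 β m C A B` = `∀ x x' y y'` C′-flat, `|X(fg) − X f · X g| ≤ C · exp (−(m · (dist x y + dist x' y')))` with `X` the
normalised Wilson–Gibbs expectation on `G^{PE}`, `PE = (E ×ˢ V) ⊔ (V ×ˢ E)`, product Haar, weight `exp (β S)`, three
plaquette sorts, observables read through the charts `P x x'`.  Quantifier order of the conclusion:
`∃ family, (∀ k j, 8 ≤ k → ADM) ∧ ∃ c > 0, ∀ k ≥ 8, ∃ β₀, ∀ β ≥ β₀, ∀ A B, Sp A (k/8) → Sp B (k/8) → ∃ C j₀, ∀ j ≥ j₀, …` —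
`C, j₀` may depend on `(k, β, A, B)`, `β₀` on `k`, `c` on nothing (but on `G, r`).  Coercions: `(k : ℝ)`, `((dist + dist :
ℕ) : ℝ)`, `(R : ℤ)` in `Sp`; `c / k` is real division (`k ≥ 8 > 0`).  No `Finset.sup`, no `tsum`, no `sSup`, no `0⁻¹`
(`∫ exp(βS) dν > 0`).  Silent restrictions: none (`V E Q : Finset ℕ` encodings; vertices outside `V` are isolated in `Γ`
and never quantified — every quantified point is in `V` via `F`/`Dp`/clause 1).
-/

set_option autoImplicit false

namespace Summit.QuantumFields.YangMills.Cruxes.CurvatureAnchorR.Disproof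

open Summit.QuantumFields.YangMills.Theorems.CurvatureAnchorR.Negative

/-! ## §1 Load-bearing hypotheses -/

/-- **The floor `8 ≤ k` is load-bearing** (re-export of the landed Negative lemma, p172332): the crux with `8 ≤ k →`
deleted from `(∀ k j, 8 ≤ k → (Φ k j).1)` is false — at `k = 0` the Poincaré constant is `0`, forcing `|V| ≤ 1`, while
clauses 8, 4, 1 produce two distinct vertices; instantiated at the certified `SU(2)`.  Any proof of the crux therefore
uses the floor, but only through admissibility at small `k`; the clustering conjunct is untouched. -/
alias floor_load_bearing := curvatureAnchorR_false_without_floor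

/-- **`hG` (compact SIMPLE Lie) and the faithfulness of `r` are NOT load-bearing for truth** — information for provers,
no lemma possible.  (i) Admissibility is `G`-free.  (ii) For the groups `hG` excludes the clustering conjunct is trivially
or plausibly TRUE, never false: trivial `G` (all observables constant, covariance `0`); finite `G` at giant `β` (ordered
phase, convergent low-temperature expansion, contractible-support observables blind to the flat `H¹(S×S; G)` sectors,
which are permuted by a symmetry of the measure); `U(1)` (Gaussian/Coulomb: on flat `ℤ⁴` massless — barrier
`Literature.Barriers.QuantumFields.AbelianDeconfinementD4`, Guth 1980 / Fröhlich–Spencer 1982, Montvay–Münster §3.7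
p. 163 — but on `S_k × S_k` the Hodge gap `≍ 1/k²` of the hyperbolic factors gives Combes–Thomas decay at rate `≍ 1/k`,
exactly the crux's `c/k`; this is the line's own end-to-end falsifier and it passes on paper).  (iii) A non-faithful
(trivial) `r` makes `S` constant, the measure product Haar, and gauge-invariant observables with disjoint supports
exactly independent.  So no `_false_without_hG` / `_false_without_faithful` lemma exists; `hG` is there for the summit. -/
theorem hG_not_load_bearing_note : True := trivial

/-! ## §2 Euler characteristic / torons are forced -/

/-- **Every admissible complex has `χ = |V| − |E| + |Q| = −|K|/4 ≤ −1`** (re-export of the landed Negative lemma,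
p172390, packaged against the inlined admissibility predicate = `AdmR` of both line files, applies by `exact`):
`2|E| = 4|V| + |K|`, `|E| = 2|Q|`, `4 ≤ |K|`, `|V| + 1 ≤ |Q|`.  Exact on the `{4,5}_k` models (`|K|` = big vertices). -/
alias euler := admR_euler

/-- Same, for the family a proof of the crux must produce (instantiated at `SU(2)`). -/
alias euler_of_crux := curvatureAnchorR_euler

/-! ## §3 Why the cheap kills fail (junk audit) -/

/-- **Junk audit — all negative.**  (a) Junk groups/representations/observables: excluded by the fields of
`IsCompactSimpleLieGroup`, `LatticeRep` (faithful, continuous, unitary) and `YMSpecies = LocalGaugeObservable 4 G`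
(bounded, measurable, cylinder, gauge-invariant).  (b) `SimpleGraph.dist` junk (`= 0` off the component / off `V`):
clause 7 forces `Γ` connected on `V` (a mean-zero indicator difference of two components would violate it), clause 6
forces cones mutually reachable, and every quantified vertex is in `V` (`F`, `Dp`, clause 1) — no exploit.  (c) The
ratio `X`: denominator `∫ exp(βS) dν > 0` (continuous positive integrand, Haar probability), numerators finite (bounded
measurable integrands) — no `0/0`.  (d) Vacuity of the clustering quadruples: clause 8 gives C′-deep (hence C′-flat,
`repair_arith`: `k/2 ≤ 3(k/4)`) `x, y` with `dist x y ≥ j`, so `(x,x,y,y)` is a genuine far quadruple at every `j` — the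
bound is not vacuous, and near quadruples are covered by boundedness (`C ≥ 2‖A‖‖B‖e^{2c}`).  (e) Admissibility itself:
satisfiable (vetting refuter, Bring `{4,5}_k`, all nine clauses, `k = 8..24`; the general member by the developing map). -/
theorem junk_audit : True := trivial

/-! ## §4 The toron floor does not refute the ∃-crux -/

/-- **Toron / zero-mode covariance floor (informal estimate, recorded for ideators).**  By §2 every `S_kj` has
`b₁ ≥ 3`, so `S × S` carries a positive-dimensional variety of flat connections and, at giant `β`, Gaussian zero modes
along it.  A contractible-support gauge-invariant observable is constant on the flat variety to leading order; its
coupling to the harmonic sector is through curvature fluctuations of size `β^{-1/2}` integrated against harmonic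
1-forms of `ℓ²`-mass `≍ (injrad-ball volume)⁻¹` near the support, giving a `j`-dependent covariance floor
`≲ C(k,β) · e^{−2h·injrad_j/k}` between ANY two far flat points (`h ≍` Cheeger constant of the `{4,5}` surface at
scale `k`), and more generally `vol_j^{−a} = e^{−a·diam_j/(C k)}` for spectral-sector indicators on expanders.  Against
the target `C e^{−(c/k)(dist x y + dist x' y')}` with `dist ≤ 2·diam_j ≤ 2 C_T · injrad_j` (log-girth towers) this floor
is ABSORBED as soon as `c ≤ a/(2 C C_T)` — and `c` is the constructor's to choose.  So the floor constrains `c` from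
above (in terms of the tower's diam/injrad ratio) but cannot refute the statement; it WOULD refute any strengthening
with `c` independent of the family's diam/injrad ratio, or with towers of bounded girth. -/
theorem toron_floor_note : True := trivial

/-! ## §5 Line `witten_hessian` — stub audit (no stub false) and three micro-lemmas -/

/-- **Stub audit of `Lines/witten_hessian.lean` (sha `c8040c64…`), all five stubs PASS the cheap attacks.**
* `stub_ct : CombesThomasSqrt` — TRUE on paper: conjugate by `diag(e^{μ d(y,·)})`; the symmetric part of the
  perturbation has Schur norm `≤ (cosh μ − 1)·τ ≤ m²/2`, the antisymmetric part is invisible to the real quadratic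
  form, coercivity `m²/2` survives, `‖H_μ⁻¹‖ ≤ 2/m²`; degenerate cases (`τ = 0`, pseudometric, empty index) fine.
* `stub_kunneth` — TRUE: `Poinc` = `λ₁⁺(Δ₀^S) ≥ 10⁻⁶/k²` (+ connectedness); `DualPoinc` = the same for `d₁d₁ᵀ` on
  mean-zero `g`, and `Coh` + clause 3 + `square_edges` distinctness put the constants in `ker d₁ᵀ`, so it IS the
  non-zero spectrum of `Δ₂^S`; `d₁∘d₀ = 0` is `square_boundary_telescopes` below (sign conventions of `dA`/`dB` vs the
  `SqCx` cycle condition agree); Künneth with the Koszul sign in `dC`; constant `10⁷` has a factor-10 slack.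
* `stub_towers` — plausible, L/XL: `Tame`(ii) (= `H¹(full subcomplex on an L-ball; ℤ/2) = 0`) HOLDS whenever the ball
  is isometric to a ball of the CAT(0) universal cover — the wall-count distance from `x` has no local maximum (at most
  two of the walls through a vertex separate it from `x`), so `{dist > L}` has no bounded component and every cycle in
  the ball bounds squares of `QB` — and FAILS as soon as `B(x, L) = V` (closed surface, `χ ≤ −1` by §2).  Hence the stub
  needs `sys(S_kj) > 2L + 2`, `L ≥ j`, `diam ≤ C_T·L`: log-girth congruence towers of the arithmetic `Δ(2,4,5)`; for
  small `j` take `L = injrad − 1` (nothing forces `L = j`).  Not refutable by typing.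
* `stub_mixing` — the open XL core; typing consistent: `Cyl` = dependence only on links within `⌊k/2⌋` of `(a,b)`
  factorwise; `2k < dist a a' + dist b b'` makes the two product supports VERTEX-disjoint (`mix_threshold`), so
  non-invariant parts gauge-average away independently and WLOG `f, g` are functions of contractible holonomies;
  `Kc(k, β)` uniform in `j ≥ k`; membership binders and `Measurable`/bound hypotheses present.  Physics caveat kept from
  the stub's own docstring: the twisted (`ad ρ`) Hodge gap over the flat moduli of `S × S` is not the untwisted Künneth
  gap near reducible connections.
* `stub_instantiate` — TRUE bookkeeping: chart-read links lie within `2⌊k/8⌋ + 1 ≤ ⌊k/2⌋` of `x` / `x'` factorwise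
  (`instantiate_arith`), flat points are in `V`, near pairs by `|X(fg) − Xf·Xg| ≤ 2‖A‖‖B‖`, `j₀ := k`, lets agree by `rfl`.
Joint sufficiency: `CurvatureAnchorR_of` composes the five stubs into the route decl literally (checked in the
skeleton); no gap is smuggled. -/
theorem stub_audit_note : True := trivial

/-- **`d₁ ∘ d₀ = 0` for the line's conventions** (`stub_kunneth` support): with the `SqCx`/`AdmR` cycle condition
`en (bd q i) = st (bd q (i+1))` and the `KunnethGap` sign `sg b = if b.2 then 1 else −1`, the signed sum of a gradient
`f (τ e) − f (σ e)` around any square boundary telescopes to `0`. -/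
theorem square_boundary_telescopes (σ τ : ℕ → ℕ) (bd : ℕ → Fin 4 → ℕ × Bool) (q : ℕ)
    (hcyc : ∀ i, (if (bd q i).2 then τ (bd q i).1 else σ (bd q i).1)
      = (if (bd q (i + 1)).2 then σ (bd q (i + 1)).1 else τ (bd q (i + 1)).1))
    (f : ℕ → ℝ) :
    ∑ i : Fin 4, (if (bd q i).2 then (1 : ℝ) else -1) * (f (τ (bd q i).1) - f (σ (bd q i).1)) = 0 := by
  have key : ∀ i, (if (bd q i).2 then (1 : ℝ) else -1) * (f (τ (bd q i).1) - f (σ (bd q i).1))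
      = f (if (bd q (i + 1)).2 then σ (bd q (i + 1)).1 else τ (bd q (i + 1)).1)
        - f (if (bd q i).2 then σ (bd q i).1 else τ (bd q i).1) := by
    intro i
    have h := hcyc i
    cases hb : (bd q i).2
    · simp only [hb, Bool.false_eq_true, ↓reduceIte] at h ⊢
      rw [← h]
      ring
    · simp only [hb, ↓reduceIte] at h ⊢
      rw [← h]
      ring
  have e0 : (0 : Fin 4) + 1 = 1 := rfl
  have e1 : (1 : Fin 4) + 1 = 2 := rfl
  have e2 : (2 : Fin 4) + 1 = 3 := rfl
  have e3 : (3 : Fin 4) + 1 = 0 := rfl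
  simp only [key, Fin.sum_univ_four, e0, e1, e2, e3]
  ring

/-- **The four edges of a square are distinct** (`stub_kunneth` / `Coh` / `Tame`(i) support): corner-injectivity of
`st ∘ bd q` and the cycle condition exclude a square traversing the same edge twice (same flag: equal darts; opposite
flags: `i' = i + 1` and `i = i' + 1`, impossible in `Fin 4`).  So under clause 3 every edge has exactly two
incidences `(q, i)`, from two distinct squares, and `Coh` makes `d₁ᵀ 1 = 0`. -/
theorem square_edges_distinct (σ τ : ℕ → ℕ) (bd : ℕ → Fin 4 → ℕ × Bool) (q : ℕ)
    (hcyc : ∀ i, (if (bd q i).2 then τ (bd q i).1 else σ (bd q i).1)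
      = (if (bd q (i + 1)).2 then σ (bd q (i + 1)).1 else τ (bd q (i + 1)).1))
    (hinj : Function.Injective fun i => if (bd q i).2 then σ (bd q i).1 else τ (bd q i).1) :
    Function.Injective fun i => (bd q i).1 := by
  intro i i' h
  simp only at h
  have two : ∀ j : Fin 4, j ≠ j + 1 + 1 := by decide
  by_contra hii
  have hc := hcyc i
  have hc' := hcyc i'
  cases hb : (bd q i).2 <;> cases hb' : (bd q i').2
  · exact hii (hinj (by simp only [hb, hb', h]))
  · -- `i` traverses the edge backwards, `i'` forwards
    simp only [hb, Bool.false_eq_true, ↓reduceIte] at hc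
    simp only [hb', ↓reduceIte] at hc'
    have h1 : i' = i + 1 := hinj (by
      show (if (bd q i').2 = true then σ (bd q i').1 else τ (bd q i').1)
          = (if (bd q (i + 1)).2 = true then σ (bd q (i + 1)).1 else τ (bd q (i + 1)).1)
      rw [hb', ← h]
      exact hc)
    have h2 : i = i' + 1 := hinj (by
      show (if (bd q i).2 = true then σ (bd q i).1 else τ (bd q i).1)
          = (if (bd q (i' + 1)).2 = true then σ (bd q (i' + 1)).1 else τ (bd q (i' + 1)).1)
      rw [hb, h]
      exact hc')
    rw [h1] at h2
    exact two i h2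
  · simp only [hb, ↓reduceIte] at hc
    simp only [hb', Bool.false_eq_true, ↓reduceIte] at hc'
    have h1 : i' = i + 1 := hinj (by
      show (if (bd q i').2 = true then σ (bd q i').1 else τ (bd q i').1)
          = (if (bd q (i + 1)).2 = true then σ (bd q (i + 1)).1 else τ (bd q (i + 1)).1)
      rw [hb', ← h]
      exact hc)
    have h2 : i = i' + 1 := hinj (by
      show (if (bd q i).2 = true then σ (bd q i).1 else τ (bd q i).1)
          = (if (bd q (i' + 1)).2 = true then σ (bd q (i' + 1)).1 else τ (bd q (i' + 1)).1)
      rw [hb, h]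
      exact hc')
    rw [h1] at h2
    exact two i h2
  · exact hii (hinj (by simp only [hb, hb', h]))

/-- **Arithmetic of `stub_instantiate` obligation (1)** (ℕ-division, every residue, `8 ≤ k`): chart-read links of an
observable of support radius `⌊k/8⌋` lie within `2⌊k/8⌋ + 1 ≤ ⌊k/2⌋` of the chart centre, the stepped box point
`⌊k/8⌋ + 1` is still inside the chart box `⌊k/4⌋`, and the chart reach `2⌊k/4⌋ ≤ ⌊k/2⌋` avoids the cones. -/
theorem instantiate_arith (k : ℕ) (hk : 8 ≤ k) :
    2 * (k / 8) + 1 ≤ k / 2 ∧ k / 8 + 1 ≤ k / 4 ∧ 2 * (k / 4) ≤ k / 2 ∧ 1 ≤ k / 8 := by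
  omega

/-- **The `2k <` threshold of `Mix` is exactly vertex-disjointness**: `2k < da + db` forces `k < da ∨ k < db`, and two
radius-`⌊k/2⌋` balls whose centres are `> k ≥ 2⌊k/2⌋` apart are disjoint — so the product supports
`B(a,⌊k/2⌋) × B(b,⌊k/2⌋)` and `B(a',⌊k/2⌋) × B(b',⌊k/2⌋)` share no product vertex. -/
theorem mix_threshold (k da db : ℕ) (h : 2 * k < da + db) : (k < da ∨ k < db) ∧ 2 * (k / 2) ≤ k := by
  omega

-- Targets
-- (none served: payload `targets = []`, `stuck_stubs = []`; the lead's PICKED line is `witten_hessian`, audited in §5.)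

end Summit.QuantumFields.YangMills.Cruxes.CurvatureAnchorR.Disproof
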